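/-
Copyright (c) 2026 the pub-hodgecm-mathlib formalisation cell (harness21).  Prover seat hodgecm-mathlib-K2E4-p11 (g6), Track B ∕ K2-LIT, h413 =
`stmt-HodgeConjecture-24833`, line `K2_E1_TraceFormulaBeta`, campaign «5Res (c) MS-2(χ,τ)», TABLE 13th issue §F row 15 (dealer K2E1-plan (g6) deal (125)), §-twin of
★ `K2E1ChiMaassSelbergFamilyCMTwo` (companion file, 400-line law): the (χ,τ) closer with its two regularity binders DISCHARGED by ★ `K2E1ChiHeckeMatrixInverseHolomorphic`.
-/
import Summits.HodgeConjecture.HodgeConjecture.Theorems.K2E1ChiMaassSelbergFamilyCMTwo          -- ★ row 15 (this seat): `exists_truncatedFamily_chi_cm_two` (binder form)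
import Summits.HodgeConjecture.HodgeConjecture.Theorems.K2E1ChiHeckeMatrixInverseHolomorphic    -- ★ (this seat): `isOpen_setOf_isUnit_of_eval`, `differentiableOn_apply_inverse_apply_of_eval`
import HarnessLib

/-!
# h413 ∕ Track B «K2-LIT», «MS-2(χ,τ)» — `K2E1ChiMaassSelbergFamilyFinDimCMTwo`: the (χ,τ) CLOSER₂ with the regularity binders discharged — finite-dimensional `V`,
# pointwise-holomorphic Hecke matrices (★ p859566's currency), vectorwise-holomorphic linear unknown `Ψ`

Cell `pub/hodgecm-mathlib`, crux H413 = `stmt-HodgeConjecture-24833`, route `HCCMUnconditional`; TABLE 13th issue §F row 15 (§-twin, own block per K2-lead R34).  THEOREMS ONLY;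
lane `--kind proof --supports stmt-HodgeConjecture-24833 --as helper` (count-neutral; closes no socket).
WHAT.  ★ `exists_truncatedFamily_chi_cm_two` takes the openness of `{z | IsUnit (𝔥_j z)}` (`h𝔥o`) and the holomorphy of `z ↦ Ψ(z)(𝔥_j(z)⁻¹ φ)` on `U ∩ {IsUnit (𝔥_j z)}` (`hΨ`) as
binders.  Here both are DISCHARGED from: `V` finite-dimensional (★ p859551 `finiteDimensional_chiSectionSpace_cm`), the Hecke matrices pointwise entire in EXACTLY the currency
★ p859566 `exists_heckeEnd_cm` delivers (`∀ ψ x, Differentiable ℂ fun z => (𝔥_j z ψ) x`), and the linear unknown holomorphic vectorwise on `U` (`∀ ψ, DifferentiableOn ℂ (fun z =>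
Ψ z ψ) U` — implied by holomorphy of `Ψ` in any of the normed currencies of ruling (119), e.g. `Hom(V, 𝔛) ≃ 𝔛^{Fin d}`), by ★ `isOpen_setOf_isUnit_of_eval` and ★
`differentiableOn_apply_inverse_apply_of_eval` (inverse of a weakly holomorphic matrix family; evaluations span the dual of a finite-dimensional function space).
* **`exists_truncatedFamily_chi_cm_two_of_pointwise`** — the head on `U ∖ P`;  **`exists_truncatedFamily_chi_cm_two_of_pointwise_upper`** — its print on
  `D₁ = ({½ < Re, 0 < Im} ∩ D_n ∩ U) ∖ P` (the `(F, hFd)` of ★ row 14 FILE 2 `poleControl_continued_chi_cm_two_of_truncatedFamily_on`).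
HONEST LABEL.  Count-neutral helper; proves no printed statement; letter-free except the X1_χ∕X2_χ binders it is fed ((E5), the cover, the per-ball clauses); HC_CM is proved only modulo
the 7 printed citations (2 remaining named inputs: hLiu418 = `stmt-HodgeConjecture-24832`, h413 = `stmt-HodgeConjecture-24833`) until rung 0 closes.

## References
* [BernsteinLapid2019] J. Bernstein, E. Lapid, *On the meromorphic continuation of Eisenstein series*, J. AMS 37 (2024) (arXiv:1911.02342), Thm 2.3, §4 Claim 1 (p. 9), Claims 4–5 (p. 10).
* [MoeglinWaldspurger1995] C. Mœglin, J.-L. Waldspurger, *Spectral decomposition and Eisenstein series* (1995), I.2.13, I.2.17, II.1.7, IV.2.3, IV.3.12 (a).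
-/

set_option autoImplicit false
-- the mandated namespace repeats `HodgeConjecture.HodgeConjecture`, as in every `Theorems/*.lean` of this sub-problem
set_option linter.dupNamespace false

noncomputable section

open MeasureTheory MeasureTheory.Measure Set NumberField IsDedekindDomain Filter Topology
open scoped NNReal ENNReal ComplexConjugate
open Literature.MeasureTheory.Group Literature.NumberTheory
open Literature.NumberTheory.Automorphic Literature.NumberTheory.Automorphic.UnitaryGroup AdelicGroupData
open Summit.HodgeConjecture.HodgeConjecture.Cruxes.H413.K2E1BLBorelSpacesU2Defs
open Summit.HodgeConjecture.HodgeConjecture.Cruxes.H413.K2E1BLBorelOperatorsU2Defs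
open Summit.HodgeConjecture.HodgeConjecture.Cruxes.H413.K2E1ChiMaassSelbergFamilyCMTwo (exists_truncatedFamily_chi_cm_two)
open Summit.HodgeConjecture.HodgeConjecture.Cruxes.H413.K2E1ChiHeckeMatrixInverseHolomorphic (isOpen_setOf_isUnit_of_eval differentiableOn_apply_inverse_apply_of_eval)

namespace Summit.HodgeConjecture.HodgeConjecture.Cruxes.H413.K2E1ChiMaassSelbergFamilyFinDimCMTwo

section Closer

variable (L : Type) [Field L] [NumberField L] [IsCMField L]
  [MeasurableSpace (quasiSplit (↥(maximalRealSubfield L)) L (IsCMField.complexConj L) 2).Adelic] [BorelSpace (quasiSplit (↥(maximalRealSubfield L)) L (IsCMField.complexConj L) 2).Adelic]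

/-- **THE (χ,τ) CLOSER₂ WITH THE REGULARITY BINDERS DISCHARGED** (module docstring): as ★ `exists_truncatedFamily_chi_cm_two`, with `V` finite-dimensional, the Hecke matrices
`𝔥_j` pointwise entire (★ p859566's clause `∀ ψ x, Differentiable ℂ fun z => (𝔥_j z ψ) x`) and the linear unknown `Ψ` holomorphic vectorwise on `U` in place of `h𝔥o`, `hΨ`.  THEN
`∃ T₀ ≥ 1, ∃ Fam, DifferentiableOn ℂ Fam (U ∖ P) ∧ ∀ z ∈ U ∖ P, Fam z =ᵐ[μ] quotFun (Λ^{T₀} (Ec z))`.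
[cite: BernsteinLapid2019, Thm 2.3, §4 Claim 1 (p. 9) and Claims 4–5 (p. 10)] [cite: MoeglinWaldspurger1995, I.2.17, II.1.7, IV.2.3] -/
theorem exists_truncatedFamily_chi_cm_two_of_pointwise
    (μ : Measure (quasiSplit (↥(maximalRealSubfield L)) L (IsCMField.complexConj L) 2).automorphicQuotient) [(quasiSplit (↥(maximalRealSubfield L)) L (IsCMField.complexConj L) 2).IsAutomorphicMeasure μ]
    (νG : Measure (quasiSplit (↥(maximalRealSubfield L)) L (IsCMField.complexConj L) 2).Adelic) [νG.IsHaarMeasure] [νG.IsInvInvariant] [SFinite νG]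
    (ν : Measure ↥(adelicUnipotent (↥(maximalRealSubfield L)) L (IsCMField.complexConj L) 2)) [ν.IsHaarMeasure] [ν.IsMulRightInvariant] [ν.IsInvInvariant]
    {𝓕 : Set ↥(adelicUnipotent (↥(maximalRealSubfield L)) L (IsCMField.complexConj L) 2)}
    (h𝓕N : IsFundamentalDomain ↥(rationalUnipotent (↥(maximalRealSubfield L)) L (IsCMField.complexConj L) 2) 𝓕 ν) (h𝓕c : IsCompact (closure 𝓕)) (h𝓕₀ : ν 𝓕 ≠ 0)
    {β : (quasiSplit (↥(maximalRealSubfield L)) L (IsCMField.complexConj L) 2).Adelic → ℝ≥0∞}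
    (hβ : IsCoveringWeight ↥((arithmeticBorel (↥(maximalRealSubfield L)) L (IsCMField.complexConj L) 2).map (quasiSplit (↥(maximalRealSubfield L)) L (IsCMField.complexConj L) 2).arithmeticSubgroup.subtype) β)
    {μZ : Measure (borelQuotient (↥(maximalRealSubfield L)) L (IsCMField.complexConj L) 2)} [SFinite μZ]
    (hμZ : ∀ f : borelQuotient (↥(maximalRealSubfield L)) L (IsCMField.complexConj L) 2 → ℝ≥0∞, Measurable f → ∫⁻ z, f z ∂μZ = ∫⁻ g, β g * f (toBorelQuotient (↥(maximalRealSubfield L)) L (IsCMField.complexConj L) 2 g) ∂νG)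
    (n : ℕ) {I : Type} [Fintype I] (η : I → GL (Fin 2) (AdeleRing (𝓞 L) L) → ℝ) (h : I → (quasiSplit (↥(maximalRealSubfield L)) L (IsCMField.complexConj L) 2).Adelic → ℂ) (a : ℝ≥0) (κ : I → ℝ≥0)
    (T : I → HX (↥(maximalRealSubfield L)) L (IsCMField.complexConj L) 2 (n + 3) μ →L[ℂ] HX (↥(maximalRealSubfield L)) L (IsCMField.complexConj L) 2 (n + 3) μ) (U : Set ℂ)
    -- the (χ,τ) currency, finite-dimensional
    (V : Submodule ℂ ((quasiSplit (↥(maximalRealSubfield L)) L (IsCMField.complexConj L) 2).Adelic → ℂ)) [FiniteDimensional ℂ ↥V] (φ : ↥V) (𝔥 : I → ℂ → Module.End ℂ ↥V)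
    (Ψ : ℂ → (↥V →ₗ[ℂ] HX (↥(maximalRealSubfield L)) L (IsCMField.complexConj L) 2 (n + 3) μ))
    (hη : ∀ i, IsTestFunctionGL 2 L (η i))
    (hdef : ∀ i, h i = fun y : (quasiSplit (↥(maximalRealSubfield L)) L (IsCMField.complexConj L) 2).Adelic => orbitalSmoothing νG (fun x : (quasiSplit (↥(maximalRealSubfield L)) L (IsCMField.complexConj L) 2).Adelic => ((η i (adelicVal (↥(maximalRealSubfield L)) L (IsCMField.complexConj L) 2 ((StdForm.antidiagonal 2).over L) x) : ℝ) : ℂ)) (fun x : (quasiSplit (↥(maximalRealSubfield L)) L (IsCMField.complexConj L) 2).Adelic => ((η i (adelicVal (↥(maximalRealSubfield L)) L (IsCMField.complexConj L) 2 ((StdForm.antidiagonal 2).over L) x) : ℝ) : ℂ)) y)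
    (hreg : ∀ i, Continuous (h i) ∧ HasCompactSupport (h i))
    (hcov : ∀ z ∈ Metric.ball (0 : ℂ) (n + 2), ∃ i, IsUnit (𝔥 i z))
    (ha : 0 < a) (hκ : ∀ i, 1 ≤ κ i)
    (hΩ : ∀ i, ∀ z : borelQuotient (↥(maximalRealSubfield L)) L (IsCMField.complexConj L) 2, ∀ y ∈ tsupport (h i), borelQuotHeight (↥(maximalRealSubfield L)) L (IsCMField.complexConj L) 2 z ≤ κ i * borelQuotHeight (↥(maximalRealSubfield L)) L (IsCMField.complexConj L) 2 (rightShift (↥(maximalRealSubfield L)) L (IsCMField.complexConj L) 2 y z))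
    (hTX : ∀ i, ∀ u : HX (↥(maximalRealSubfield L)) L (IsCMField.complexConj L) 2 (n + 3) μ, (T i u : (quasiSplit (↥(maximalRealSubfield L)) L (IsCMField.complexConj L) 2).automorphicQuotient → ℂ) =ᵐ[μ.withDensity fun x => (((supHeight (↥(maximalRealSubfield L)) L (IsCMField.complexConj L) 2 x)⁻¹ ^ (2 * (n + 3)) : ℝ≥0) : ℝ≥0∞)]
      fun ξ => ∫ y, h i y * (u : (quasiSplit (↥(maximalRealSubfield L)) L (IsCMField.complexConj L) 2).automorphicQuotient → ℂ) (y⁻¹ • ξ) ∂νG)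
    (hUo : IsOpen U) (hUD : U ⊆ Metric.ball (0 : ℂ) (n + 2))
    -- the regularity, in ★ p859566's pointwise currency and vectorwise for `Ψ`
    (h𝔥 : ∀ i (ψ : ↥V) (x : (quasiSplit (↥(maximalRealSubfield L)) L (IsCMField.complexConj L) 2).Adelic),
      Differentiable ℂ fun z : ℂ => ((𝔥 i z ψ : ↥V) : (quasiSplit (↥(maximalRealSubfield L)) L (IsCMField.complexConj L) 2).Adelic → ℂ) x)
    (hΨ : ∀ ψ : ↥V, DifferentiableOn ℂ (fun z : ℂ => Ψ z ψ) U)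
    (Ec : ℂ → (quasiSplit (↥(maximalRealSubfield L)) L (IsCMField.complexConj L) 2).Adelic → ℂ) (P : Set ℂ)
    (hE5 : ∀ j, ∀ z ∈ U, z ∉ P → IsUnit (𝔥 j z) → ∀ g : (quasiSplit (↥(maximalRealSubfield L)) L (IsCMField.complexConj L) 2).Adelic,
      Ec z g = ∫ y, h j y * ((Ψ z (Ring.inverse (𝔥 j z) φ) : HX (↥(maximalRealSubfield L)) L (IsCMField.complexConj L) 2 (n + 3) μ) : (quasiSplit (↥(maximalRealSubfield L)) L (IsCMField.complexConj L) 2).automorphicQuotient → ℂ)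
          ((quasiSplit (↥(maximalRealSubfield L)) L (IsCMField.complexConj L) 2).toAutomorphicQuotient (g * y)⁻¹) ∂νG) :
    ∃ T₀ : ℝ≥0, 1 ≤ T₀ ∧ ∃ Fam : ℂ → Lp ℂ 2 μ, DifferentiableOn ℂ Fam (U \ P) ∧
      ∀ z ∈ U \ P, ((Fam z : Lp ℂ 2 μ) : (quasiSplit (↥(maximalRealSubfield L)) L (IsCMField.complexConj L) 2).automorphicQuotient → ℂ) =ᵐ[μ]
        (quasiSplit (↥(maximalRealSubfield L)) L (IsCMField.complexConj L) 2).quotFun (truncation ν 𝓕 T₀ (Ec z)) :=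
  exists_truncatedFamily_chi_cm_two L μ νG ν h𝓕N h𝓕c h𝓕₀ hβ hμZ n η h a κ T U V φ 𝔥 Ψ hη hdef hreg hcov ha hκ hΩ hTX hUo hUD
    (fun i => isOpen_setOf_isUnit_of_eval V (h𝔥 i)) (fun i => differentiableOn_apply_inverse_apply_of_eval V (h𝔥 i) hΨ φ) Ec P hE5

/-- **THE DISCHARGED (χ,τ) CLOSER ON THE UPPER DOMAIN `D₁ := (D⁺ ∩ D_n ∩ U) ∖ P`, `D⁺ = {½ < Re z, 0 < Im z}`** — the `(F, hFd)` of ★ row 14 FILE 2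
`poleControl_continued_chi_cm_two_of_truncatedFamily_on` at `D₁ = ({z | ½ < z.re ∧ 0 < z.im} ∩ ball 0 (n+2) ∩ U) ∖ P`. [cite: BernsteinLapid2019, §4 Claims 4–5 (p. 10)]
[cite: MoeglinWaldspurger1995, IV.2.3, IV.3.12 (a)] -/
theorem exists_truncatedFamily_chi_cm_two_of_pointwise_upper
    (μ : Measure (quasiSplit (↥(maximalRealSubfield L)) L (IsCMField.complexConj L) 2).automorphicQuotient) [(quasiSplit (↥(maximalRealSubfield L)) L (IsCMField.complexConj L) 2).IsAutomorphicMeasure μ]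
    (νG : Measure (quasiSplit (↥(maximalRealSubfield L)) L (IsCMField.complexConj L) 2).Adelic) [νG.IsHaarMeasure] [νG.IsInvInvariant] [SFinite νG]
    (ν : Measure ↥(adelicUnipotent (↥(maximalRealSubfield L)) L (IsCMField.complexConj L) 2)) [ν.IsHaarMeasure] [ν.IsMulRightInvariant] [ν.IsInvInvariant]
    {𝓕 : Set ↥(adelicUnipotent (↥(maximalRealSubfield L)) L (IsCMField.complexConj L) 2)}
    (h𝓕N : IsFundamentalDomain ↥(rationalUnipotent (↥(maximalRealSubfield L)) L (IsCMField.complexConj L) 2) 𝓕 ν) (h𝓕c : IsCompact (closure 𝓕)) (h𝓕₀ : ν 𝓕 ≠ 0)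
    {β : (quasiSplit (↥(maximalRealSubfield L)) L (IsCMField.complexConj L) 2).Adelic → ℝ≥0∞}
    (hβ : IsCoveringWeight ↥((arithmeticBorel (↥(maximalRealSubfield L)) L (IsCMField.complexConj L) 2).map (quasiSplit (↥(maximalRealSubfield L)) L (IsCMField.complexConj L) 2).arithmeticSubgroup.subtype) β)
    {μZ : Measure (borelQuotient (↥(maximalRealSubfield L)) L (IsCMField.complexConj L) 2)} [SFinite μZ]
    (hμZ : ∀ f : borelQuotient (↥(maximalRealSubfield L)) L (IsCMField.complexConj L) 2 → ℝ≥0∞, Measurable f → ∫⁻ z, f z ∂μZ = ∫⁻ g, β g * f (toBorelQuotient (↥(maximalRealSubfield L)) L (IsCMField.complexConj L) 2 g) ∂νG)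
    (n : ℕ) {I : Type} [Fintype I] (η : I → GL (Fin 2) (AdeleRing (𝓞 L) L) → ℝ) (h : I → (quasiSplit (↥(maximalRealSubfield L)) L (IsCMField.complexConj L) 2).Adelic → ℂ) (a : ℝ≥0) (κ : I → ℝ≥0)
    (T : I → HX (↥(maximalRealSubfield L)) L (IsCMField.complexConj L) 2 (n + 3) μ →L[ℂ] HX (↥(maximalRealSubfield L)) L (IsCMField.complexConj L) 2 (n + 3) μ) (U : Set ℂ)
    (V : Submodule ℂ ((quasiSplit (↥(maximalRealSubfield L)) L (IsCMField.complexConj L) 2).Adelic → ℂ)) [FiniteDimensional ℂ ↥V] (φ : ↥V) (𝔥 : I → ℂ → Module.End ℂ ↥V)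
    (Ψ : ℂ → (↥V →ₗ[ℂ] HX (↥(maximalRealSubfield L)) L (IsCMField.complexConj L) 2 (n + 3) μ))
    (hη : ∀ i, IsTestFunctionGL 2 L (η i))
    (hdef : ∀ i, h i = fun y : (quasiSplit (↥(maximalRealSubfield L)) L (IsCMField.complexConj L) 2).Adelic => orbitalSmoothing νG (fun x : (quasiSplit (↥(maximalRealSubfield L)) L (IsCMField.complexConj L) 2).Adelic => ((η i (adelicVal (↥(maximalRealSubfield L)) L (IsCMField.complexConj L) 2 ((StdForm.antidiagonal 2).over L) x) : ℝ) : ℂ)) (fun x : (quasiSplit (↥(maximalRealSubfield L)) L (IsCMField.complexConj L) 2).Adelic => ((η i (adelicVal (↥(maximalRealSubfield L)) L (IsCMField.complexConj L) 2 ((StdForm.antidiagonal 2).over L) x) : ℝ) : ℂ)) y)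
    (hreg : ∀ i, Continuous (h i) ∧ HasCompactSupport (h i))
    (hcov : ∀ z ∈ Metric.ball (0 : ℂ) (n + 2), ∃ i, IsUnit (𝔥 i z))
    (ha : 0 < a) (hκ : ∀ i, 1 ≤ κ i)
    (hΩ : ∀ i, ∀ z : borelQuotient (↥(maximalRealSubfield L)) L (IsCMField.complexConj L) 2, ∀ y ∈ tsupport (h i), borelQuotHeight (↥(maximalRealSubfield L)) L (IsCMField.complexConj L) 2 z ≤ κ i * borelQuotHeight (↥(maximalRealSubfield L)) L (IsCMField.complexConj L) 2 (rightShift (↥(maximalRealSubfield L)) L (IsCMField.complexConj L) 2 y z))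
    (hTX : ∀ i, ∀ u : HX (↥(maximalRealSubfield L)) L (IsCMField.complexConj L) 2 (n + 3) μ, (T i u : (quasiSplit (↥(maximalRealSubfield L)) L (IsCMField.complexConj L) 2).automorphicQuotient → ℂ) =ᵐ[μ.withDensity fun x => (((supHeight (↥(maximalRealSubfield L)) L (IsCMField.complexConj L) 2 x)⁻¹ ^ (2 * (n + 3)) : ℝ≥0) : ℝ≥0∞)]
      fun ξ => ∫ y, h i y * (u : (quasiSplit (↥(maximalRealSubfield L)) L (IsCMField.complexConj L) 2).automorphicQuotient → ℂ) (y⁻¹ • ξ) ∂νG)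
    (hUo : IsOpen U) (hUD : U ⊆ Metric.ball (0 : ℂ) (n + 2))
    (h𝔥 : ∀ i (ψ : ↥V) (x : (quasiSplit (↥(maximalRealSubfield L)) L (IsCMField.complexConj L) 2).Adelic),
      Differentiable ℂ fun z : ℂ => ((𝔥 i z ψ : ↥V) : (quasiSplit (↥(maximalRealSubfield L)) L (IsCMField.complexConj L) 2).Adelic → ℂ) x)
    (hΨ : ∀ ψ : ↥V, DifferentiableOn ℂ (fun z : ℂ => Ψ z ψ) U)
    (Ec : ℂ → (quasiSplit (↥(maximalRealSubfield L)) L (IsCMField.complexConj L) 2).Adelic → ℂ) (P : Set ℂ)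
    (hE5 : ∀ j, ∀ z ∈ U, z ∉ P → IsUnit (𝔥 j z) → ∀ g : (quasiSplit (↥(maximalRealSubfield L)) L (IsCMField.complexConj L) 2).Adelic,
      Ec z g = ∫ y, h j y * ((Ψ z (Ring.inverse (𝔥 j z) φ) : HX (↥(maximalRealSubfield L)) L (IsCMField.complexConj L) 2 (n + 3) μ) : (quasiSplit (↥(maximalRealSubfield L)) L (IsCMField.complexConj L) 2).automorphicQuotient → ℂ)
          ((quasiSplit (↥(maximalRealSubfield L)) L (IsCMField.complexConj L) 2).toAutomorphicQuotient (g * y)⁻¹) ∂νG) :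
    ∃ T₀ : ℝ≥0, 1 ≤ T₀ ∧ ∃ Fam : ℂ → Lp ℂ 2 μ, DifferentiableOn ℂ Fam (({z : ℂ | 1 / 2 < z.re ∧ 0 < z.im} ∩ Metric.ball (0 : ℂ) (n + 2) ∩ U) \ P) ∧
      ∀ z ∈ ({z : ℂ | 1 / 2 < z.re ∧ 0 < z.im} ∩ Metric.ball (0 : ℂ) (n + 2) ∩ U) \ P,
        ((Fam z : Lp ℂ 2 μ) : (quasiSplit (↥(maximalRealSubfield L)) L (IsCMField.complexConj L) 2).automorphicQuotient → ℂ) =ᵐ[μ]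
          (quasiSplit (↥(maximalRealSubfield L)) L (IsCMField.complexConj L) 2).quotFun (truncation ν 𝓕 T₀ (Ec z)) := by
  obtain ⟨T₀, hT₀, Fam, hFd, hFam⟩ := exists_truncatedFamily_chi_cm_two_of_pointwise L μ νG ν h𝓕N h𝓕c h𝓕₀ hβ hμZ n η h a κ T U V φ 𝔥 Ψ hη hdef hreg hcov ha hκ hΩ hTX hUo hUD h𝔥 hΨ Ec P hE5
  have hsub : ({z : ℂ | 1 / 2 < z.re ∧ 0 < z.im} ∩ Metric.ball (0 : ℂ) (n + 2) ∩ U) \ P ⊆ U \ P := fun z hz => ⟨hz.1.2, hz.2⟩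
  exact ⟨T₀, hT₀, Fam, hFd.mono hsub, fun z hz => hFam z (hsub hz)⟩

end Closer

end Summit.HodgeConjecture.HodgeConjecture.Cruxes.H413.K2E1ChiMaassSelbergFamilyFinDimCMTwo

end
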